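import Literature.AlgebraicGeometry.Resolution.MacaulayficationPrincipalization
import Literature.AlgebraicGeometry.Resolution.CanonicalResolutionProofs
import Mathlib.AlgebraicGeometry.IdealSheaf.Functorial
import Mathlib.AlgebraicGeometry.FunctionField
import HarnessLib

/-!
# The Cohen–Macaulay Cartier hull from Česnavičius's principalization
(crux `FrobeniusLadder.FRationalModification`, line `birth`, stub `stub_cmCartierHull`, conditional)

Crux `stmt-ResolutionOfSingularities-15316`, line `birth`: its stub `stub_cmCartierHull` (every integral
separated finite-type `Y/k` with Cohen–Macaulay stalks has a proper birational integral Cohen–Macaulay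
model `W → Y` with an effective Cartier divisor off whose support `W` is regular) follows from the named
fact `Literature.AlgebraicGeometry.Resolution.CesnaviciusPrincipalization` (Česnavičius 2021, §1
Cor. (principalize)) applied to the vanishing ideal sheaf of the NON-REGULAR LOCUS of `Y` — closed for
schemes locally of finite type over ANY field (tree `isOpen_regularLocus_of_locallyOfFiniteType_field`,
Matsumura Cor. to Thm. 30.5), and not everything (the generic stalk is the function field):
`cmCartierHull_of_principalization`. The pulled-back ideal sheaf is the divisor (Mathlib
`Scheme.IdealSheafData.comap`, `support_comap`), and off it `π` is a local isomorphism
(`isIso_stalkMap_of_isIso_morphismRestrict`, Mathlib `morphismRestrictStalkMap`), so regularity transports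
along the stalk isomorphism. CONDITIONAL on the named fact (taken as the hypothesis `hC`).

## References

* K. Česnavičius, *Macaulayfication of Noetherian schemes*, Duke Math. J. 170 (2021), §1 Cor.
  (principalize). [Cesnavicius2021]
* H. Matsumura, *Commutative Ring Theory* (1986), §30, Cor. to Thm. 30.5. [Matsumura1987]
-/

-- single-problem summit: the doubled namespace component `ResolutionOfSingularities` is forced
set_option linter.dupNamespace false

noncomputable section

open CategoryTheory AlgebraicGeometry TopologicalSpace
open Literature.AlgebraicGeometry.Resolution

namespace Summit.ResolutionOfSingularities.ResolutionOfSingularities.Theorems.FRationalModification.CmCartierHull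

universe u

/-- If `π` is an isomorphism over the open `U ⊆ Y` and `π w ∈ U`, then the stalk map
`𝒪_{Y, π w} → 𝒪_{X, w}` is an isomorphism (Mathlib `morphismRestrictStalkMap`). [folklore] -/
theorem isIso_stalkMap_of_isIso_morphismRestrict {X Y : Scheme.{u}} (π : X ⟶ Y) (U : Y.Opens)
    [IsIso (π ∣_ U)] (w : X) (hw : π.base w ∈ U) : IsIso (π.stalkMap w) := by
  have hw' : w ∈ π ⁻¹ᵁ U := hw
  haveI : IsIso ((π ∣_ U).stalkMap ⟨w, hw'⟩) := inferInstance
  exact (Arrow.isIso_iff_isIso_of_isIso (morphismRestrictStalkMap π U ⟨w, hw'⟩).hom).mp this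

/-- **`stub_cmCartierHull` from Česnavičius's principalization.** For an integral separated
finite-type `Y/k` with Cohen–Macaulay stalks: principalize the (reduced) non-regular locus
`Z = Y ∖ Reg(Y)` (closed: `isOpen_regularLocus_of_locallyOfFiniteType_field`; `≠ Y`: the generic stalk
is a field) by `CesnaviciusPrincipalization`; the model `π : W → Y` is proper birational, `W` integral
with Cohen–Macaulay stalks, `D := Z·𝒪_W = Z.comap π` is an effective Cartier divisor with
`Supp D = π⁻¹(Z)` (Mathlib `support_comap`), and off `Supp D` the point `π w` is regular and `π` is
an isomorphism near `w`, so `𝒪_{W,w} ≅ 𝒪_{Y,π w}` is regular. [cite: Cesnavicius2021, §1 Corollary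
(principalize) after Thm. 1.6; Matsumura1987, §30, Cor. to Thm. 30.5] -/
theorem cmCartierHull_of_principalization (hC : CesnaviciusPrincipalization.{0}) (k : Type) [Field k]
    (Y : Scheme.{0}) (g : Y ⟶ Spec (.of k)) [IsSeparated g] [LocallyOfFiniteType g]
    [QuasiCompact g] [IsIntegral Y]
    (hCM : ∀ y : Y, ∀ d : ℕ, ringKrullDim (Y.presheaf.stalk y) = d →
      ∀ s : Fin d → Y.presheaf.stalk y, (Ideal.span (Set.range s)).radical.IsMaximal →
        RingTheory.Sequence.IsWeaklyRegular (Y.presheaf.stalk y) (List.ofFn s)) :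
    ∃ (W : Scheme.{0}) (π : W ⟶ Y), IsProper π ∧ IsBirational π ∧ IsIntegral W ∧
      (∀ w : W, ∀ d : ℕ, ringKrullDim (W.presheaf.stalk w) = d →
        ∀ s : Fin d → W.presheaf.stalk w, (Ideal.span (Set.range s)).radical.IsMaximal →
          RingTheory.Sequence.IsWeaklyRegular (W.presheaf.stalk w) (List.ofFn s)) ∧
      ∃ D : W.IdealSheafData, IsEffectiveCartier D ∧
        ∀ w : W, w ∉ D.support → IsRegularLocalRing (W.presheaf.stalk w) := by
  -- the non-regular locus, as a closed subscheme with its reduced (vanishing-ideal) structure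
  have hopen : IsOpen (Scheme.regularLocus Y) := isOpen_regularLocus_of_locallyOfFiniteType_field g
  let C : Closeds Y := ⟨(Scheme.regularLocus Y)ᶜ, hopen.isClosed_compl⟩
  let Z : Y.IdealSheafData := Scheme.IdealSheafData.vanishingIdeal C
  have hZsupp : (Z.support : Set Y) = (Scheme.regularLocus Y)ᶜ :=
    Scheme.IdealSheafData.coe_support_vanishingIdeal C
  -- it is not everything: the generic point is regular (its stalk is the function field)
  have hξ : genericPoint Y ∈ Scheme.regularLocus Y := by
    change IsRegularLocalRing Y.functionField
    infer_instance
  have hZ : Z.support ≠ ⊤ := by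
    intro h
    have : genericPoint Y ∈ (Z.support : Set Y) := by rw [h]; trivial
    rw [hZsupp] at this
    exact this hξ
  -- principalize
  obtain ⟨W, π, hπ, hbir, hW, hWCM, hcart, hiso⟩ := hC k Y g ‹_› ‹_› ‹_› ‹_› hCM Z hZ
  refine ⟨W, π, hπ, hbir, hW, hWCM, Z.comap π, hcart, fun w hw => ?_⟩
  -- off `Supp (Z.comap π) = π⁻¹ Supp Z`: `π w` is a regular point …
  have hπw : π.base w ∉ (Z.support : Set Y) := by
    intro h
    apply hw
    rw [Scheme.IdealSheafData.support_comap]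
    exact h
  have hreg : IsRegularLocalRing (Y.presheaf.stalk (π.base w)) := by
    rw [hZsupp] at hπw
    exact not_not.mp hπw
  -- … and `π` is an isomorphism near `w`
  haveI := hiso
  haveI : IsIso (π.stalkMap w) := isIso_stalkMap_of_isIso_morphismRestrict π Z.support.compl w hπw
  exact IsRegularLocalRing.of_ringEquiv (asIso (π.stalkMap w)).commRingCatIsoToRingEquiv

end Summit.ResolutionOfSingularities.ResolutionOfSingularities.Theorems.FRationalModification.CmCartierHull

end
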